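import Mathlib
import Summits.ValiantsHypothesis.ValiantsHypothesis.Theorems.BarrierLeverPartitionMinorsHitByVPHiddenStatesSplitRule

/-!
# Route BarrierLever — item `PartitionMinorsHitByVP` (stmt-ValiantsHypothesis-19717):
# affinely independent hidden families are UNIVERSAL (general form, via the split rule)

Helper file (`--supports stmt-ValiantsHypothesis-19717`; cell valiant-natproofs, rung V4, 𝒟-side of door (c); prover seat
val-np-p3 gen 7). One auxiliary `def` (`homog`, the homogenised indicator vector of a hidden set); closes NO item.
Route-independent (imports the split-rule engine only).

`…HiddenStatesSimplex.symbGood_of_card_le_one` proved universality for hidden families of sets of size `≤ 1`. Here the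
hypothesis is the natural one: the homogenised indicator vectors `(1, 1_{e k}) ∈ ℚ^{1+K}` are LINEARLY INDEPENDENT (the hidden
points are affinely independent). Then

* `exists_flat_of_linearIndependent` — every set of columns is an exact hyperplane section (a linear functional prescribed on a
  linearly independent family extends to the whole space: `Module.Basis.span`, `Module.Basis.constr`, `LinearMap.exists_extend`);
* **`symbGood_of_linearIndependent`** — every injective column family is symbolically good against such a hidden family
  (induction on the number of rows by `symbGood_of_split`, splitting at a coordinate separating two columns).

Cell record: this is the full «affinely independent ⇒ universal» statement used informally by the split-rule census (memo
HOME/val-np-p3/g7); sub-configurations of affinely independent configurations are affinely independent, which is what makes the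
induction close. WHAT THIS IS NOT: nothing beyond the radius-one regime of Q\* follows for ball–colex families (their larger
members are affinely dependent); nothing on CPM, crux 14610 or VP ≠ VNP.
-/

set_option linter.dupNamespace false

namespace Summit.ValiantsHypothesis.ValiantsHypothesis.Theorems.BarrierLever.HiddenStates

open Finset Matrix MvPolynomial

noncomputable section

variable {K h : ℕ}

/-- The homogenised indicator vector `(1, 1_J) ∈ ℚ^{Option (Fin K)}` of a hidden set `J` (coordinate `none` carries the `1`). -/
def homog (J : Finset (Fin K)) : Option (Fin K) → ℚ :=
  fun o => Option.elim o 1 fun q => if q ∈ J then 1 else 0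

/-- `homog J` in terms of the standard basis. -/
theorem homog_eq_sum (J : Finset (Fin K)) :
    homog J = Pi.single none 1 + ∑ q ∈ J, Pi.single (some q) 1 := by
  funext o
  rw [Pi.add_apply, Finset.sum_apply]
  cases o with
  | none => simp [homog]
  | some q =>
    simp only [homog, Option.elim, Pi.single_apply, Option.some.injEq]
    rw [Finset.sum_ite_eq J q (fun _ => (1 : ℚ))]
    simp

/-- **Every subset of an affinely independent hidden family is an exact hyperplane section.** If the vectors `homog (e k)`
are linearly independent over `ℚ`, then for every set `C₀` of columns there are constants `c₀, c` with
`c₀ + Σ_{q ∈ e k} c q = 0 ↔ k ∈ C₀`. -/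
theorem exists_flat_of_linearIndependent {n : Type*} [Fintype n] [DecidableEq n] (e : n → Finset (Fin K))
    (hli : LinearIndependent ℚ fun k => homog (e k)) (C₀ : Finset n) :
    ∃ (c₀ : ℂ) (c : Fin K → ℂ), ∀ k, (c₀ + ∑ q ∈ e k, c q = 0 ↔ k ∈ C₀) := by
  classical
  -- a functional on the span taking the value `[k ∉ C₀]` at `homog (e k)`, extended to the whole space
  let b := Module.Basis.span hli
  let f₀ : Submodule.span ℚ (Set.range fun k => homog (e k)) →ₗ[ℚ] ℚ :=
    b.constr ℚ fun k => if k ∈ C₀ then (0 : ℚ) else 1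
  obtain ⟨g, hg⟩ := LinearMap.exists_extend f₀
  have hgv : ∀ k, g (homog (e k)) = if k ∈ C₀ then (0 : ℚ) else 1 := by
    intro k
    have h1 : (b k : Option (Fin K) → ℚ) = homog (e k) := by
      rw [show b k = ⟨homog (e k), _⟩ from Module.Basis.span_apply hli k]
    have h2 : g (b k) = f₀ (b k) := by
      rw [← hg]; rfl
    rw [← h1, h2]
    exact b.constr_basis ℚ _ k
  refine ⟨(g (Pi.single none 1) : ℂ), fun q => (g (Pi.single (some q) 1) : ℂ), fun k => ?_⟩
  have hsum : (g (Pi.single none 1) : ℂ) + ∑ q ∈ e k, (g (Pi.single (some q) 1) : ℂ) =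
      ((g (homog (e k)) : ℚ) : ℂ) := by
    rw [homog_eq_sum, map_add, map_sum]
    push_cast
    rfl
  rw [hsum, hgv k]
  by_cases hk : k ∈ C₀
  · simp [hk]
  · simp [hk]

/-- **Universality of affinely independent hidden families (general form).** If the homogenised indicator vectors of the
hidden sets are linearly independent, then EVERY injective column family is symbolically good. -/
theorem symbGood_of_linearIndependent {n : Type*} [Fintype n] [DecidableEq n] (u : n → Finset (Fin h))
    (hu : Function.Injective u) (e : n → Finset (Fin K)) (hli : LinearIndependent ℚ fun k => homog (e k)) :
    SymbGood u e := by
  classical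
  suffices H : ∀ (m : ℕ) (n : Type) [Fintype n] [DecidableEq n], Fintype.card n = m →
      ∀ (u : n → Finset (Fin h)) (e : n → Finset (Fin K)), Function.Injective u →
        (LinearIndependent ℚ fun k => homog (e k)) → SymbGood u e by
    let ε := Fintype.equivFin n
    have hmain := H (Fintype.card n) (Fin (Fintype.card n)) (by simp) (u ∘ ε.symm) (e ∘ ε.symm)
      (hu.comp ε.symm.injective) (hli.comp _ ε.symm.injective)
    intro hzero
    apply hmain
    have hre : symbAdd (u ∘ ε.symm) (e ∘ ε.symm) = (symbAdd u e).submatrix ε.symm ε.symm := by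
      refine Matrix.ext fun i k => ?_
      simp only [symbAdd, Matrix.of_apply, Matrix.submatrix_apply, Function.comp]
    unfold SymbGood at *
    rw [hre, Matrix.det_submatrix_equiv_self, hzero]
  intro m
  induction m using Nat.strong_induction_on with
  | _ m ih =>
    intro n _ _ hn u e hu hli
    by_cases hsub : Subsingleton n
    · exact symbGood_of_subsingleton u e
    obtain ⟨i, j, hij⟩ : ∃ i j : n, i ≠ j := by
      by_contra hno
      push Not at hno
      exact hsub ⟨hno⟩
    have huij : u i ≠ u j := fun h' => hij (hu h')
    obtain ⟨i₁, j₀, a, hai, haj⟩ : ∃ i₁ j₀ : n, ∃ a : Fin h, a ∈ u i₁ ∧ a ∉ u j₀ := by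
      by_cases hsub' : u i ⊆ u j
      · have : ¬ u j ⊆ u i := fun h' => huij (Finset.Subset.antisymm hsub' h')
        obtain ⟨a, ha, hna⟩ := Finset.not_subset.mp this
        exact ⟨j, i, a, ha, hna⟩
      · obtain ⟨a, ha, hna⟩ := Finset.not_subset.mp hsub'
        exact ⟨i, j, a, ha, hna⟩
    have hcard₀ : Fintype.card {i // a ∉ u i} < m := by
      rw [← hn]
      exact Fintype.card_subtype_lt fun h' => h' hai
    have hcard₁ : Fintype.card {i // a ∈ u i} < m := by
      rw [← hn]
      exact Fintype.card_subtype_lt (x := j₀) haj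
    obtain ⟨C₀, -, hC₀⟩ := Finset.exists_subset_card_eq
      (show Fintype.card {i // a ∉ u i} ≤ (Finset.univ : Finset n).card from by
        rw [Finset.card_univ]; exact Fintype.card_subtype_le _)
    obtain ⟨c₀, c, hφ⟩ := exists_flat_of_linearIndependent e hli C₀
    have hcardφ : Fintype.card {k // c₀ + ∑ q ∈ e k, c q = 0} = Fintype.card {i // a ∉ u i} := by
      rw [← hC₀, ← Fintype.card_coe]
      exact Fintype.card_congr (Equiv.subtypeEquivRight fun k => hφ k)
    have hcardφ' : Fintype.card {k // c₀ + ∑ q ∈ e k, c q ≠ 0} = Fintype.card {i // a ∈ u i} := by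
      have h1 : Fintype.card {k // ¬ (c₀ + ∑ q ∈ e k, c q = 0)} =
          Fintype.card n - Fintype.card {k // c₀ + ∑ q ∈ e k, c q = 0} := Fintype.card_subtype_compl _
      have h2 : Fintype.card {i // ¬ (a ∈ u i)} = Fintype.card n - Fintype.card {i // a ∈ u i} :=
        Fintype.card_subtype_compl _
      have h3 : Fintype.card {i // a ∈ u i} ≤ Fintype.card n := Fintype.card_subtype_le _
      show Fintype.card {k // ¬ (c₀ + ∑ q ∈ e k, c q = 0)} = _
      rw [h1, hcardφ, h2]; omega
    let κ₀ : {i // a ∉ u i} ≃ {k // c₀ + ∑ q ∈ e k, c q = 0} := Fintype.equivOfCardEq hcardφ.symm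
    let κ₁ : {i // a ∈ u i} ≃ {k // c₀ + ∑ q ∈ e k, c q ≠ 0} := Fintype.equivOfCardEq hcardφ'.symm
    refine symbGood_of_split u e a c₀ c κ₁ κ₀ ?_ ?_
    · refine ih _ hcard₁ {i // a ∈ u i} rfl _ _ ?_ ?_
      · intro x y hxy
        apply Subtype.ext
        apply hu
        have := congrArg (insert a) hxy
        simp only [Finset.insert_erase x.2, Finset.insert_erase y.2] at this
        exact this
      · exact hli.comp _ (Subtype.val_injective.comp κ₁.injective)
    · refine ih _ hcard₀ {i // a ∉ u i} rfl _ _ ?_ ?_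
      · exact hu.comp Subtype.val_injective
      · exact hli.comp _ (Subtype.val_injective.comp κ₀.injective)

end

end Summit.ValiantsHypothesis.ValiantsHypothesis.Theorems.BarrierLever.HiddenStates
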